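import Summits.AtomisticToContinuum.Crystallization.Theorems.LoopTunnelDialContactLaw
import Summits.AtomisticToContinuum.Crystallization.Theorems.OverbindingBudgetCubeTails

/-!
# LoopTunnelDial — far TAILS at `7/10`-separation (kit 7a) (lens-5 g19 range dial; crux `PocketCase`, stmt-AtomisticToContinuum-27294)

Kit file 7a (imports the landed `ContactLaw` and the tree's dyadic count `OverbindingBudgetCubeTails`).  Near/far index sets of a particle at range `R`;
the ENERGY TAIL `tailE R = 72·(10/7)³·R⁻³` and FORCE TAIL `tailF R = 432·(10/7)³·R⁻³·(R⁻¹ + R⁻⁷)` of an injective `7/10`-separated configuration beyond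
range `R ≥ 1` (`sum_far_abs_lennardJones_le`, `abs_sum_far_forceTerm_le`), the one-ball packing count `card_le_of_finRange`, the reach numerals at `R = 8`,
and the GENERAL-TAIL interfaces `InvSixTail R τ` (`∑_{far} r⁻⁶ ≤ τ`) / `FarTails R E F` with `farTails_of_invSixTail` (any certified `τ` gives
`E = τ/6`, `F = (R⁻¹ + R⁻⁷)·τ`) and the tree instance `farTails_tree`.

Every `def` below is line vocabulary of the LoopTunnelDial contact dial (crux stmt-AtomisticToContinuum-27294), not a cited fact.  0 sorry.
-/

noncomputable section

namespace Summit.AtomisticToContinuum.Crystallization.Theorems.LoopTunnelDialRangeTails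

open scoped BigOperators Classical InnerProductSpace
open Literature.MathematicalPhysics.StatisticalMechanics
open Literature.MathematicalPhysics.StatisticalMechanics.Yuhjtman2015 (hLJ)
open Summit.AtomisticToContinuum.Crystallization.Theorems.GrainPercolationDialCrossCeiling (E3 ballChunk)
open Summit.AtomisticToContinuum.Crystallization.Theorems.ChargedEnergyGapNegative (eStar)
open Summit.AtomisticToContinuum.Crystallization.Theorems.OverbindingBudgetCubeTails (sum_inv_pow_six_le_dyadic)
open Summit.AtomisticToContinuum.Crystallization.Theorems.LoopTunnelDialContactLaw

variable {N : ℕ}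

/-! ### Near/far index sets and the two tails (PROVED) -/

/-- The particles other than `k` within range `R` of `y k`. -/
def nearIdx (R : ℝ) {N : ℕ} (y : Fin N → E3) (k : Fin N) : Finset (Fin N) :=
  (Finset.univ.erase k).filter (fun m => dist (y k) (y m) ≤ R)

/-- The particles other than `k` beyond range `R` of `y k`. -/
def farIdx (R : ℝ) {N : ℕ} (y : Fin N → E3) (k : Fin N) : Finset (Fin N) :=
  (Finset.univ.erase k).filter (fun m => ¬ dist (y k) (y m) ≤ R)

/-- Any one-centre sum splits into its near and far parts. -/
theorem sum_erase_eq_near_add_far (R : ℝ) (y : Fin N → E3) (k : Fin N) (f : Fin N → ℝ) :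
    ∑ m ∈ Finset.univ.erase k, f m = ∑ m ∈ nearIdx R y k, f m + ∑ m ∈ farIdx R y k, f m := by
  unfold nearIdx farIdx
  rw [Finset.sum_filter_add_sum_filter_not]

/-- The ENERGY TAIL constant `tailE R = 72·(7/10)⁻³·R⁻³` (`≈ 210/R³`). -/
def tailE (R : ℝ) : ℝ := 72 * ((7 : ℝ) / 10)⁻¹ ^ 3 * R⁻¹ ^ 3

/-- The FORCE TAIL constant `tailF R = 432·(7/10)⁻³·R⁻³·(R⁻¹ + R⁻⁷)` (`≈ 1260·(R⁻⁴ + R⁻¹⁰)`). -/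
def tailF (R : ℝ) : ℝ := 432 * ((7 : ℝ) / 10)⁻¹ ^ 3 * R⁻¹ ^ 3 * (R⁻¹ + R⁻¹ ^ 7)

/-- The energy tail is nonnegative. -/
theorem tailE_nonneg {R : ℝ} (hR : 0 ≤ R) : 0 ≤ tailE R := by unfold tailE; positivity

/-- The force tail is nonnegative. -/
theorem tailF_nonneg {R : ℝ} (hR : 0 ≤ R) : 0 ≤ tailF R := by unfold tailF; positivity

/-- **Dyadic shell count over the far indices (tree):** `∑_{m far} r_{km}⁻⁶ ≤ 432·(7/10)⁻³·R⁻³`. -/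
theorem sum_far_inv_pow_six_le {y : Fin N → E3} (hy : Function.Injective y)
    (hsep : ∀ i j : Fin N, i ≠ j → (7 : ℝ) / 10 ≤ dist (y i) (y j)) (k : Fin N) {R : ℝ} (hR : 7 / 10 ≤ R) :
    ∑ m ∈ farIdx R y k, (dist (y k) (y m))⁻¹ ^ 6 ≤ 432 * ((7 : ℝ) / 10)⁻¹ ^ 3 * R⁻¹ ^ 3 := by
  have h := sum_inv_pow_six_le_dyadic ((farIdx R y k).image y) (y k) (δ := 7 / 10) (ρ := R) (by norm_num) hR
    (fun z hz => by
      obtain ⟨m, hm, rfl⟩ := Finset.mem_image.1 hz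
      exact (not_le.1 (Finset.mem_filter.1 hm).2).le)
    (fun z hz w hw hzw => by
      obtain ⟨m, hm, rfl⟩ := Finset.mem_image.1 hz
      obtain ⟨m', hm', rfl⟩ := Finset.mem_image.1 hw
      exact hsep m m' (fun h => hzw (congrArg y h)))
  rwa [Finset.sum_image (fun a _ b _ h => hy h)] at h

/-- `|V_LJ(t)| ≤ t⁻⁶/6` for `t ≥ 1`. -/
theorem abs_lennardJones_le_of_one_le {t : ℝ} (ht : 1 ≤ t) : |lennardJones t| ≤ 1 / 6 * t⁻¹ ^ 6 := by
  have h0 : 0 ≤ t⁻¹ := inv_nonneg.2 (by linarith)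
  have h1 : t⁻¹ ≤ 1 := inv_le_one_of_one_le₀ ht
  have h6 : t⁻¹ ^ 6 ≤ 1 := pow_le_one₀ h0 h1
  have h6' : 0 ≤ t⁻¹ ^ 6 := pow_nonneg h0 6
  have h12 : t⁻¹ ^ 12 = t⁻¹ ^ 6 * t⁻¹ ^ 6 := by ring
  unfold lennardJones
  rw [h12, abs_le]
  constructor <;> nlinarith [mul_le_mul_of_nonneg_right h6 h6', mul_nonneg h6' h6']

/-- **THE ENERGY TAIL (PROVED):** beyond range `R ≥ 1` the site energy of any particle of an injective `7/10`-separated configuration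
carries at most `tailE R` in absolute value. -/
theorem sum_far_abs_lennardJones_le {y : Fin N → E3} (hy : Function.Injective y)
    (hsep : ∀ i j : Fin N, i ≠ j → (7 : ℝ) / 10 ≤ dist (y i) (y j)) (k : Fin N) {R : ℝ} (hR : 1 ≤ R) :
    ∑ m ∈ farIdx R y k, |lennardJones (dist (y k) (y m))| ≤ tailE R := by
  have h1 : ∀ m ∈ farIdx R y k, |lennardJones (dist (y k) (y m))| ≤ 1 / 6 * (dist (y k) (y m))⁻¹ ^ 6 := fun m hm =>
    abs_lennardJones_le_of_one_le (hR.trans (not_le.1 (Finset.mem_filter.1 hm).2).le)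
  have h2 := sum_far_inv_pow_six_le hy hsep k (by linarith : (7 : ℝ) / 10 ≤ R)
  calc ∑ m ∈ farIdx R y k, |lennardJones (dist (y k) (y m))|
      ≤ ∑ m ∈ farIdx R y k, 1 / 6 * (dist (y k) (y m))⁻¹ ^ 6 := Finset.sum_le_sum h1
    _ = 1 / 6 * ∑ m ∈ farIdx R y k, (dist (y k) (y m))⁻¹ ^ 6 := (Finset.mul_sum _ _ _).symm
    _ ≤ 1 / 6 * (432 * ((7 : ℝ) / 10)⁻¹ ^ 3 * R⁻¹ ^ 3) := by gcongr
    _ = tailE R := by unfold tailE; ring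

/-- The Lennard-Jones FORCE TERM exerted on a particle at `x` by a particle at `z`, tested against `e`:
`V′(r)·⟪x − z, e⟫/r` with `V′(r) = −(1/12)(12r⁻¹³ − 12r⁻⁷)` — the summand of `ForceBalancedAt`. -/
def forceTerm (x z e : E3) : ℝ :=
  -(1 / 12) * (12 * (dist x z)⁻¹ ^ 13 - 12 * (dist x z)⁻¹ ^ 7) * (⟪x - z, e⟫_ℝ / dist x z)

/-- `ForceBalancedAt` in the `forceTerm` vocabulary (definitional). -/
theorem forceBalancedAt_iff (y : Fin N → E3) (k : Fin N) :
    ForceBalancedAt y k ↔ ∀ e : E3, ∑ m ∈ Finset.univ.erase k, forceTerm (y k) (y m) e = 0 := Iff.rfl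

/-- One far force term: `|V′(r)·⟪x − z, e⟫/r| ≤ (R⁻¹ + R⁻⁷)·r⁻⁶·‖e‖` for `r > R ≥ 1` (Cauchy–Schwarz and `r⁻⁷ ≤ R⁻¹r⁻⁶`, `r⁻¹³ ≤ R⁻⁷r⁻⁶`). -/
theorem abs_forceTerm_le {x z e : E3} {R : ℝ} (hR : 1 ≤ R) (hRz : R < dist x z) :
    |forceTerm x z e| ≤ (R⁻¹ + R⁻¹ ^ 7) * (dist x z)⁻¹ ^ 6 * ‖e‖ := by
  set t : ℝ := dist x z with ht
  have ht0 : 0 < t := by linarith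
  have hcs : |⟪x - z, e⟫_ℝ / t| ≤ ‖e‖ := by
    rw [abs_div, abs_of_pos ht0, div_le_iff₀ ht0]
    calc |⟪x - z, e⟫_ℝ| ≤ ‖x - z‖ * ‖e‖ := abs_real_inner_le_norm _ _
      _ = ‖e‖ * t := by rw [ht, dist_eq_norm, mul_comm]
  have hti : 0 ≤ t⁻¹ := inv_nonneg.2 ht0.le
  have hRi : 0 ≤ R⁻¹ := inv_nonneg.2 (by linarith)
  have htR : t⁻¹ ≤ R⁻¹ := inv_anti₀ (by linarith) hRz.le
  have h7 : t⁻¹ ^ 7 ≤ R⁻¹ ^ 7 := pow_le_pow_left₀ hti htR 7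
  have ht6 : 0 ≤ t⁻¹ ^ 6 := pow_nonneg hti 6
  have h13' : t⁻¹ ^ 13 ≤ R⁻¹ ^ 7 * t⁻¹ ^ 6 := by
    calc t⁻¹ ^ 13 = t⁻¹ ^ 7 * t⁻¹ ^ 6 := by ring
      _ ≤ R⁻¹ ^ 7 * t⁻¹ ^ 6 := mul_le_mul_of_nonneg_right h7 ht6
  have h7' : t⁻¹ ^ 7 ≤ R⁻¹ * t⁻¹ ^ 6 := by
    calc t⁻¹ ^ 7 = t⁻¹ * t⁻¹ ^ 6 := by ring
      _ ≤ R⁻¹ * t⁻¹ ^ 6 := mul_le_mul_of_nonneg_right htR ht6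
  have hcoef : |-(1 / 12) * (12 * t⁻¹ ^ 13 - 12 * t⁻¹ ^ 7)| ≤ (R⁻¹ + R⁻¹ ^ 7) * t⁻¹ ^ 6 := by
    rw [abs_le]
    constructor
    · nlinarith [pow_nonneg hti 13, mul_nonneg hRi ht6]
    · nlinarith [pow_nonneg hti 7, mul_nonneg (pow_nonneg hRi 7) ht6]
  calc |forceTerm x z e| = |-(1 / 12) * (12 * t⁻¹ ^ 13 - 12 * t⁻¹ ^ 7)| * |⟪x - z, e⟫_ℝ / t| := by
        rw [forceTerm, ← ht, abs_mul]
    _ ≤ (R⁻¹ + R⁻¹ ^ 7) * t⁻¹ ^ 6 * ‖e‖ :=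
        mul_le_mul hcoef hcs (abs_nonneg _) (by positivity)

/-- **THE FORCE TAIL (PROVED):** beyond range `R ≥ 1` the net Lennard-Jones force on any particle of an injective `7/10`-separated
configuration, tested against `e`, is at most `tailF R · ‖e‖`. -/
theorem abs_sum_far_forceTerm_le {y : Fin N → E3} (hy : Function.Injective y)
    (hsep : ∀ i j : Fin N, i ≠ j → (7 : ℝ) / 10 ≤ dist (y i) (y j)) (k : Fin N) {R : ℝ} (hR : 1 ≤ R) (e : E3) :
    |∑ m ∈ farIdx R y k, forceTerm (y k) (y m) e| ≤ tailF R * ‖e‖ := by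
  have h1 : ∀ m ∈ farIdx R y k, |forceTerm (y k) (y m) e| ≤ (R⁻¹ + R⁻¹ ^ 7) * (dist (y k) (y m))⁻¹ ^ 6 * ‖e‖ := fun m hm =>
    abs_forceTerm_le hR (not_le.1 (Finset.mem_filter.1 hm).2)
  have h2 := sum_far_inv_pow_six_le hy hsep k (by linarith : (7 : ℝ) / 10 ≤ R)
  have hRi : 0 ≤ R⁻¹ := inv_nonneg.2 (by linarith)
  calc |∑ m ∈ farIdx R y k, forceTerm (y k) (y m) e|
      ≤ ∑ m ∈ farIdx R y k, |forceTerm (y k) (y m) e| := Finset.abs_sum_le_sum_abs _ _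
    _ ≤ ∑ m ∈ farIdx R y k, (R⁻¹ + R⁻¹ ^ 7) * (dist (y k) (y m))⁻¹ ^ 6 * ‖e‖ := Finset.sum_le_sum h1
    _ = (R⁻¹ + R⁻¹ ^ 7) * ‖e‖ * ∑ m ∈ farIdx R y k, (dist (y k) (y m))⁻¹ ^ 6 := by
        rw [Finset.mul_sum]
        exact Finset.sum_congr rfl (fun m _ => by ring)
    _ ≤ (R⁻¹ + R⁻¹ ^ 7) * ‖e‖ * (432 * ((7 : ℝ) / 10)⁻¹ ^ 3 * R⁻¹ ^ 3) :=
        mul_le_mul_of_nonneg_left h2 (by positivity)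
    _ = tailF R * ‖e‖ := by unfold tailF; ring

/-- **FINITENESS of the range (tree packing):** a `7/10`-separated point set in a closed `R`-ball has at most `(20R/7 + 1)³` points. -/
theorem card_le_of_finRange {s : Finset E3} {x : E3} {R : ℝ} (hR : 0 ≤ R) (hin : ∀ z ∈ s, dist x z ≤ R)
    (hsep : ∀ z ∈ s, ∀ w ∈ s, z ≠ w → (7 : ℝ) / 10 ≤ dist z w) : (s.card : ℝ) ≤ (2 * R / (7 / 10) + 1) ^ 3 := by
  have h := card_le_of_separated_of_dist_le s x (r := 7 / 10) (by norm_num) hR (fun z hz => by rw [dist_comm]; exact hin z hz) hsep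
  rwa [finrank_euclideanSpace_fin] at h

/-- The truncation of a configuration to the closed `R`-ball about `y p` as a point set, and its bookkeeping. -/
theorem truncation_facts {y : Fin N → E3} (hy : Function.Injective y)
    (hsep : ∀ i j : Fin N, i ≠ j → (7 : ℝ) / 10 ≤ dist (y i) (y j)) (p : Fin N) {R : ℝ} (hR0 : 0 ≤ R) :
    let s : Finset E3 := insert (y p) ((nearIdx R y p).image y)
    y p ∈ s ∧ s.erase (y p) = (nearIdx R y p).image y ∧ (∀ z ∈ s, dist (y p) z ≤ R) ∧
      (∀ z ∈ s, ∀ w ∈ s, z ≠ w → (7 : ℝ) / 10 ≤ dist z w) ∧ (∀ z ∈ s, ∃ m : Fin N, y m = z) := by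
  intro s
  have hk_notin : y p ∉ (nearIdx R y p).image y := by
    intro hmem
    obtain ⟨m, hm, hmk⟩ := Finset.mem_image.1 hmem
    exact Finset.ne_of_mem_erase (Finset.mem_filter.1 hm).1 (hy hmk)
  have hpre : ∀ z ∈ s, ∃ m : Fin N, y m = z := by
    intro z hz
    rcases Finset.mem_insert.1 hz with rfl | hz
    · exact ⟨p, rfl⟩
    · obtain ⟨m, -, rfl⟩ := Finset.mem_image.1 hz
      exact ⟨m, rfl⟩
  refine ⟨Finset.mem_insert_self _ _, Finset.erase_insert hk_notin, ?_, ?_, hpre⟩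
  · intro z hz
    rcases Finset.mem_insert.1 hz with rfl | hz
    · rw [dist_self]; exact hR0
    · obtain ⟨m, hm, rfl⟩ := Finset.mem_image.1 hz
      exact (Finset.mem_filter.1 hm).2
  · intro z hz w hw hzw
    obtain ⟨m, rfl⟩ := hpre z hz
    obtain ⟨m', rfl⟩ := hpre w hw
    exact hsep m m' (fun hh => hzw (congrArg y hh))

/-! ### General certified tails (interfaces) and the tree instance -/

/-- `InvSixTail R τ`: in every injective `7/10`-separated configuration, `∑_{m : r_{km} > R} r_{km}⁻⁶ ≤ τ`. -/
def InvSixTail (R τ : ℝ) : Prop :=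
  ∀ (N : ℕ) (y : Fin N → E3), Function.Injective y → (∀ i j : Fin N, i ≠ j → (7 : ℝ) / 10 ≤ dist (y i) (y j)) →
    ∀ k : Fin N, ∑ m ∈ farIdx R y k, (dist (y k) (y m))⁻¹ ^ 6 ≤ τ

/-- `FarTails R E F`: beyond range `R` the far energy is at most `E` in absolute sum and the far force at most `F·‖e‖`. -/
def FarTails (R E F : ℝ) : Prop :=
  ∀ (N : ℕ) (y : Fin N → E3), Function.Injective y → (∀ i j : Fin N, i ≠ j → (7 : ℝ) / 10 ≤ dist (y i) (y j)) →
    ∀ k : Fin N, (∑ m ∈ farIdx R y k, |lennardJones (dist (y k) (y m))| ≤ E) ∧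
      ∀ e : E3, |∑ m ∈ farIdx R y k, forceTerm (y k) (y m) e| ≤ F * ‖e‖

/-- The tree's dyadic tail as an `InvSixTail`. -/
theorem invSixTail_tree {R : ℝ} (hR : 7 / 10 ≤ R) : InvSixTail R (432 * ((7 : ℝ) / 10)⁻¹ ^ 3 * R⁻¹ ^ 3) :=
  fun _ _ hy hsep k => sum_far_inv_pow_six_le hy hsep k hR

/-- **Energy and force tails from an inverse-sixth-power tail (PROVED):** `InvSixTail R τ ⟹ FarTails R (τ/6) ((R⁻¹ + R⁻⁷)·τ)` for `R ≥ 1`. -/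
theorem farTails_of_invSixTail {R τ : ℝ} (hR : 1 ≤ R) (hτ : InvSixTail R τ) : FarTails R (1 / 6 * τ) ((R⁻¹ + R⁻¹ ^ 7) * τ) := by
  intro N y hy hsep k
  have h2 := hτ N y hy hsep k
  have hRi : 0 ≤ R⁻¹ := inv_nonneg.2 (by linarith)
  constructor
  · have h1 : ∀ m ∈ farIdx R y k, |lennardJones (dist (y k) (y m))| ≤ 1 / 6 * (dist (y k) (y m))⁻¹ ^ 6 := fun m hm =>
      abs_lennardJones_le_of_one_le (hR.trans (not_le.1 (Finset.mem_filter.1 hm).2).le)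
    calc ∑ m ∈ farIdx R y k, |lennardJones (dist (y k) (y m))|
        ≤ ∑ m ∈ farIdx R y k, 1 / 6 * (dist (y k) (y m))⁻¹ ^ 6 := Finset.sum_le_sum h1
      _ = 1 / 6 * ∑ m ∈ farIdx R y k, (dist (y k) (y m))⁻¹ ^ 6 := (Finset.mul_sum _ _ _).symm
      _ ≤ 1 / 6 * τ := by gcongr
  · intro e
    have h1 : ∀ m ∈ farIdx R y k, |forceTerm (y k) (y m) e| ≤ (R⁻¹ + R⁻¹ ^ 7) * (dist (y k) (y m))⁻¹ ^ 6 * ‖e‖ := fun m hm =>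
      abs_forceTerm_le hR (not_le.1 (Finset.mem_filter.1 hm).2)
    calc |∑ m ∈ farIdx R y k, forceTerm (y k) (y m) e|
        ≤ ∑ m ∈ farIdx R y k, |forceTerm (y k) (y m) e| := Finset.abs_sum_le_sum_abs _ _
      _ ≤ ∑ m ∈ farIdx R y k, (R⁻¹ + R⁻¹ ^ 7) * (dist (y k) (y m))⁻¹ ^ 6 * ‖e‖ := Finset.sum_le_sum h1
      _ = (R⁻¹ + R⁻¹ ^ 7) * ‖e‖ * ∑ m ∈ farIdx R y k, (dist (y k) (y m))⁻¹ ^ 6 := by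
          rw [Finset.mul_sum]
          exact Finset.sum_congr rfl (fun m _ => by ring)
      _ ≤ (R⁻¹ + R⁻¹ ^ 7) * ‖e‖ * τ := by gcongr
      _ = (R⁻¹ + R⁻¹ ^ 7) * τ * ‖e‖ := by ring

/-- The tree's tails `(tailE R, tailF R)` as `FarTails`. -/
theorem farTails_tree {R : ℝ} (hR : 1 ≤ R) : FarTails R (tailE R) (tailF R) := by
  have h := farTails_of_invSixTail hR (invSixTail_tree (by linarith : (7 : ℝ) / 10 ≤ R))
  have hE : 1 / 6 * (432 * ((7 : ℝ) / 10)⁻¹ ^ 3 * R⁻¹ ^ 3) = tailE R := by unfold tailE; ring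
  have hF : (R⁻¹ + R⁻¹ ^ 7) * (432 * ((7 : ℝ) / 10)⁻¹ ^ 3 * R⁻¹ ^ 3) = tailF R := by unfold tailF; ring
  rwa [hE, hF] at h

/-! ### Reach numerals at `R = 8` and `R = 6, 7` -/

/-- `tailE 8 < 0.41`. -/
theorem tailE_eight : tailE 8 < 41 / 100 := by unfold tailE; norm_num

/-- `tailF 8 < 0.31` — against a contact push `|V′(3/4)| = 34.65…`. -/
theorem tailF_eight : tailF 8 < 31 / 100 := by unfold tailF; norm_num

/-- `tailE 6 < 0.98`, `tailE 7 < 0.62` — range `6` needs a finite floor `β ≥ +0.27`, range `7` needs `β ≥ −0.09`. -/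
theorem tailE_six_seven : tailE 6 < 98 / 100 ∧ tailE 7 < 62 / 100 := by unfold tailE; constructor <;> norm_num

/-- `12·tailE 8 < 4.92` (the LOAD tail at range 8, in `h`-units). -/
theorem twelve_tailE_eight : 12 * tailE 8 < 492 / 100 := by unfold tailE; norm_num

end Summit.AtomisticToContinuum.Crystallization.Theorems.LoopTunnelDialRangeTails
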